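import Summits.KontsevichZagierPeriods.KontsevichZagierPeriods.Theorems.UnfoldedStokesStokesGenerationFibrewiseRungReparam
import Summits.KontsevichZagierPeriods.KontsevichZagierPeriods.Theorems.UnfoldedStokesStokesGenerationFibrewiseRungScalingSwaps

/-!
# `StokesGeneration` (stmt-KontsevichZagierPeriods-3586) — line `fibrewise_stokes`, stub `stub_diagReparam`

Registered stub P1 of the line `fibrewise_stokes` of the crux `StokesGeneration` (route UnfoldedStokes; residual S2
`FibStokesDecomposable`, `Theorems/UnfoldedStokesDefs.lean`): **Kontsevich–Zagier's rule (2) for DIAGONAL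
reparametrisations of the closed cube.** For an integrand `f` on `[0,1]^N` (`ℚ`-semialgebraic, continuous, `C¹` along
every coordinate with `ℚ`-semialgebraic continuous fibre derivatives `fD a`) and one-variable new coordinates
`ψ a : [0,1] → [0,1]` (`ℚ`-semialgebraic, continuous, `C¹` inside with `ℚ`-semialgebraic continuous derivative `ψ' a`,
`ψ a 0 = 0`, `ψ a 1 = 1`, `0 < ψ a < 1` inside), the change-of-variables relator of the diagonal map
`Ψ(x) = (ψ a (x a))ₐ`, namely `f(x) − f(Ψ x) · ∏ₐ ψ' a (x a)`, is fibrewise-Stokes decomposable.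

Proof (bookkeeping over the landed one-coordinate rung 13 `fibStokesDecomposable_sub_reparam`). Substitute the
coordinates one at a time: for a finite set `s` of coordinates put `Ψ_s x = (b ∈ s ? ψ b (x b) : x b)` and
`J_s x = ∏_{b ∈ s} ψ' b (x b)`, and prove by `Finset` induction that `R_s = f − (f ∘ Ψ_s) · J_s` is decomposable.
For `s = ∅` this is the zero function. For `insert a s` with `a ∉ s`, the cocycle identity
`R_{insert a s} = R_s + (g − g(x[a ↦ ψ a (x a)]) · ψ' a (x a))` with `g = (f ∘ Ψ_s) · J_s` holds POINTWISE
(`Ψ_s` commutes with updating the free coordinate `a`, `J_s` ignores it, `J_{insert a s} = ψ' a (x a) · J_s`), the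
second summand is rung 13 applied along `a` to `g` (fibre derivative `(fD a ∘ Ψ_s) · J_s`; semialgebraicity of
`f ∘ Ψ_s` by composition with the semialgebraic continuous self-map `Ψ_s` of the cube), and the class is closed under
sums (`fibStokesDecomposable_add`) and pointwise agreement on the cube (`fibStokesDecomposable_congr_off_null`).
At `s = univ` the relator is the claimed one. No Jacobian determinants beyond the diagonal product, no transcendence
input, no value hypothesis.

References: M. Kontsevich, D. Zagier, *Periods* (2001), §1.2 rules (2), (3); J. Ayoub, Ann. of Math. 181 (2015),
Rem. 1.5.
-/

noncomputable section

-- `Summit.KontsevichZagierPeriods.KontsevichZagierPeriods.…` is the tree's mandated layout (single-conjunct summit).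
set_option linter.dupNamespace false

namespace Summit.KontsevichZagierPeriods.KontsevichZagierPeriods.Cruxes.StokesGeneration.FibrewiseStokes

open MeasureTheory Set
open Literature.NumberTheory.Transcendental
open Literature.NumberTheory.Transcendental.KZ
open Literature.ModelTheory.ExponentialFields (IsSemialgebraic)

/-- **Registered stub `stub_diagReparam` (P1): rule (2) for diagonal reparametrisations of the closed cube.**
For `f` on `[0,1]^N` (`ℚ`-semialgebraic, continuous, `C¹` along each coordinate `a` with `ℚ`-semialgebraic continuous
fibre derivative `fD a`) and endpoint-fixing one-variable coordinates `ψ a` (`ℚ`-semialgebraic, continuous, `C¹`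
inside `[0,1]` with `ℚ`-semialgebraic continuous derivative `ψ' a`, `ψ a 0 = 0`, `ψ a 1 = 1`, `0 < ψ a < 1` inside),
the relator `f(x) − f((ψ a (x a))ₐ) · ∏ₐ ψ' a (x a)` of the diagonal map is fibrewise-Stokes decomposable: iterate
the one-coordinate rung 13 over the coordinates through the cocycle identity of change-of-variables relators.
[cite: KontsevichZagier2001, §1.2 rules (2), (3)] -/
theorem stub_diagReparam {N : ℕ} (f : (Fin N → ℝ) → ℝ) (fD : Fin N → (Fin N → ℝ) → ℝ) (ψ ψ' : Fin N → ℝ → ℝ)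
    (hf : IsSemialgebraicFunOn ℚ (Set.pi Set.univ (fun _ : Fin N => Set.Icc (0:ℝ) 1)) f)
    (hfD : ∀ a, IsSemialgebraicFunOn ℚ (Set.pi Set.univ (fun _ : Fin N => Set.Icc (0:ℝ) 1)) (fD a))
    (hfc : ContinuousOn f (Set.pi Set.univ (fun _ : Fin N => Set.Icc (0:ℝ) 1)))
    (hfDc : ∀ a, ContinuousOn (fD a) (Set.pi Set.univ (fun _ : Fin N => Set.Icc (0:ℝ) 1)))
    (hfd : ∀ a, ∀ x ∈ Set.pi Set.univ (fun _ : Fin N => Set.Icc (0:ℝ) 1), x a ∈ Set.Ioo (0:ℝ) 1 →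
      HasDerivAt (fun s => f (Function.update x a s)) (fD a x) (x a))
    (hψ : ∀ a, IsSemialgebraicFunOn ℚ (Set.pi Set.univ (fun _ : Fin 1 => Set.Icc (0:ℝ) 1)) (fun z => ψ a (z 0)))
    (hψ' : ∀ a, IsSemialgebraicFunOn ℚ (Set.pi Set.univ (fun _ : Fin 1 => Set.Icc (0:ℝ) 1)) (fun z => ψ' a (z 0)))
    (hψc : ∀ a, ContinuousOn (ψ a) (Set.Icc (0:ℝ) 1)) (hψ'c : ∀ a, ContinuousOn (ψ' a) (Set.Icc (0:ℝ) 1))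
    (hψd : ∀ a, ∀ u ∈ Set.Ioo (0:ℝ) 1, HasDerivAt (ψ a) (ψ' a u) u)
    (hψ0 : ∀ a, ψ a 0 = 0) (hψ1 : ∀ a, ψ a 1 = 1) (hψIoo : ∀ a, ∀ u ∈ Set.Ioo (0:ℝ) 1, ψ a u ∈ Set.Ioo (0:ℝ) 1) :
    FibStokesDecomposable N (fun x => f x - f (fun a => ψ a (x a)) * ∏ a, ψ' a (x a)) := by
  set C : Set (Fin N → ℝ) := Set.pi Set.univ (fun _ : Fin N => Set.Icc (0:ℝ) 1) with hC
  have hCsa : IsSemialgebraic ℚ C := by rw [hC, ← cube_eq_pi]; exact isSemialgebraic_cube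
  have hmem : ∀ x ∈ C, ∀ i, x i ∈ Set.Icc (0:ℝ) 1 := fun x hx i => (Set.mem_univ_pi.mp hx) i
  -- `ψ b` maps `[0,1]` into `[0,1]`
  have hψI : ∀ b, ∀ u ∈ Set.Icc (0:ℝ) 1, ψ b u ∈ Set.Icc (0:ℝ) 1 := by
    intro b u hu
    rcases hu.1.eq_or_lt with h0 | hpos
    · rw [← h0, hψ0 b]; exact ⟨le_rfl, zero_le_one⟩
    rcases hu.2.eq_or_lt with h1 | hlt1
    · rw [h1, hψ1 b]; exact ⟨zero_le_one, le_rfl⟩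
    · exact Set.Ioo_subset_Icc_self (hψIoo b u ⟨hpos, hlt1⟩)
  -- readings of one-variable continuous functions along a coordinate
  have hreadc : ∀ g : ℝ → ℝ, ContinuousOn g (Set.Icc (0:ℝ) 1) → ∀ j : Fin N,
      ContinuousOn (fun x : Fin N → ℝ => g (x j)) C :=
    fun g hg j => hg.comp (continuous_apply j).continuousOn fun x hx => hmem x hx j
  -- the partial diagonal substitutions `Ψ s` (coordinates in `s` substituted) and their Jacobians `J s`
  obtain ⟨Ψ, hΨ⟩ : ∃ Ψ : Finset (Fin N) → (Fin N → ℝ) → (Fin N → ℝ),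
      Ψ = fun s x b => if b ∈ s then ψ b (x b) else x b := ⟨_, rfl⟩
  obtain ⟨J, hJ⟩ : ∃ J : Finset (Fin N) → (Fin N → ℝ) → ℝ, J = fun s x => ∏ b ∈ s, ψ' b (x b) := ⟨_, rfl⟩
  have hΨC : ∀ s, ∀ x ∈ C, Ψ s x ∈ C := by
    intro s x hx
    refine Set.mem_univ_pi.mpr fun b => ?_
    simp only [hΨ]
    split_ifs
    · exact hψI b _ (hmem x hx b)
    · exact hmem x hx b
  have hΨsa : ∀ s, IsSemialgebraicMapOn ℚ C (Ψ s) := by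
    intro s
    refine IsSemialgebraicMapOn.of_forall hCsa fun j => ?_
    by_cases hj : j ∈ s
    · exact (isSemialgebraicFunOn_read (hψ j) j).congr fun x _ => by simp [hΨ, hj]
    · exact (isSemialgebraicFunOn_apply hCsa j).congr fun x _ => by simp [hΨ, hj]
  have hΨc : ∀ s, ContinuousOn (Ψ s) C := by
    intro s
    refine continuousOn_pi' fun j => ?_
    by_cases hj : j ∈ s
    · exact (hreadc (ψ j) (hψc j) j).congr fun x _ => by simp [hΨ, hj]
    · exact (continuous_apply j).continuousOn.congr fun x _ => by simp [hΨ, hj]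
  have hJsa : ∀ s, IsSemialgebraicFunOn ℚ C (J s) := by
    intro s; rw [hJ]
    exact IsSemialgebraicFunOn.fun_finsetProd s hCsa fun b _ => isSemialgebraicFunOn_read (hψ' b) b
  have hJc : ∀ s, ContinuousOn (J s) C := by
    intro s; rw [hJ]
    exact continuousOn_finsetProd s fun b _ => hreadc (ψ' b) (hψ'c b) b
  -- the relator of `Ψ s` is decomposable, for every set `s` of substituted coordinates
  have key : ∀ s : Finset (Fin N), FibStokesDecomposable N (fun x => f x - f (Ψ s x) * J s x) := by
    intro s
    induction s using Finset.induction_on with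
    | empty =>
      refine fibStokesDecomposable_congr_off_null N _ _ ∅
        Literature.ModelTheory.ExponentialFields.isSemialgebraic_empty measure_empty (fun x _ _ => ?_)
        (fibStokesDecomposable_zero N)
      simp [hΨ, hJ]
    | insert a s ha ih =>
      -- the substituted integrand `g = (f ∘ Ψ s) · J s` and its fibre derivative `gₐ` along the free coordinate `a`
      obtain ⟨g, hg⟩ : ∃ g : (Fin N → ℝ) → ℝ, g = fun x => f (Ψ s x) * J s x := ⟨_, rfl⟩
      obtain ⟨gₐ, hgₐ⟩ : ∃ gₐ : (Fin N → ℝ) → ℝ, gₐ = fun x => fD a (Ψ s x) * J s x := ⟨_, rfl⟩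
      have hfΨ : IsSemialgebraicFunOn ℚ C (fun x => f (Ψ s x)) :=
        IsSemialgebraicFunOn.comp_isSemialgebraicMapOn_holds hf (hΨsa s) (hΨC s)
      have hfDΨ : IsSemialgebraicFunOn ℚ C (fun x => fD a (Ψ s x)) :=
        IsSemialgebraicFunOn.comp_isSemialgebraicMapOn_holds (hfD a) (hΨsa s) (hΨC s)
      have hgsa : IsSemialgebraicFunOn ℚ C g := by rw [hg]; exact hfΨ.fun_mul (hJsa s)
      have hgₐsa : IsSemialgebraicFunOn ℚ C gₐ := by rw [hgₐ]; exact hfDΨ.fun_mul (hJsa s)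
      have hgc : ContinuousOn g C := by rw [hg]; exact (hfc.comp (hΨc s) (hΨC s)).mul (hJc s)
      have hgₐc : ContinuousOn gₐ C := by rw [hgₐ]; exact ((hfDc a).comp (hΨc s) (hΨC s)).mul (hJc s)
      -- `Ψ s` commutes with updating the free coordinate `a ∉ s`, and `J s` ignores it
      have hΨupd : ∀ x t, Ψ s (Function.update x a t) = Function.update (Ψ s x) a t := by
        intro x t; ext b
        rcases eq_or_ne b a with rfl | hba
        · simp [hΨ, ha]
        · simp [hΨ, Function.update_of_ne hba]
      have hJupd : ∀ x t, J s (Function.update x a t) = J s x := by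
        intro x t; rw [hJ]
        refine Finset.prod_congr rfl fun b hb => ?_
        rw [Function.update_of_ne (fun h : b = a => ha (h ▸ hb))]
      have hΨa : ∀ x, Ψ s x a = x a := fun x => by simp [hΨ, ha]
      -- rung 13 along `a`, applied to `g`
      have hrel := fibStokesDecomposable_sub_reparam a g gₐ (fun x => ψ a (x a)) (fun x => ψ' a (x a))
        hgsa hgₐsa (isSemialgebraicFunOn_read (hψ a) a) (isSemialgebraicFunOn_read (hψ' a) a) hgc hgₐc
        (hreadc (ψ a) (hψc a) a) (hreadc (ψ' a) (hψ'c a) a)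
        (fun x hx hxa => by
          have hd := hfd a (Ψ s x) (hΨC s x hx) (by rw [hΨa]; exact hxa)
          rw [hΨa] at hd
          have := hd.mul_const (J s x)
          rw [hg, hgₐ]
          simpa only [hΨupd, hJupd] using this)
        (fun x _ hxa => by simpa using hψd a (x a) hxa)
        (fun x _ hxa => by simp only [hxa, hψ0])
        (fun x _ hxa => by simp only [hxa, hψ1])
        (fun x _ hxa => hψIoo a (x a) hxa)
      -- the cocycle identity, pointwise on the cube
      refine fibStokesDecomposable_congr_off_null N _ _ ∅
        Literature.ModelTheory.ExponentialFields.isSemialgebraic_empty measure_empty (fun x _ _ => ?_)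
        (fibStokesDecomposable_add N _ _ ih hrel)
      have hΨins : Ψ s (Function.update x a (ψ a (x a))) = Ψ (insert a s) x := by
        rw [hΨupd]; ext b
        rcases eq_or_ne b a with rfl | hba
        · simp [hΨ]
        · simp [hΨ, Finset.mem_insert, hba]
      have hJins : J (insert a s) x = ψ' a (x a) * J s x := by rw [hJ]; exact Finset.prod_insert ha
      simp only [hg, hJupd, hΨins, hJins]
      ring
  refine fibStokesDecomposable_congr_off_null N _ _ ∅
    Literature.ModelTheory.ExponentialFields.isSemialgebraic_empty measure_empty (fun x _ _ => ?_) (key Finset.univ)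
  simp [hΨ, hJ]

end Summit.KontsevichZagierPeriods.KontsevichZagierPeriods.Cruxes.StokesGeneration.FibrewiseStokes

end
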